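import Literature.NumberTheory.LFunctions.ZetaZerosShortIntervalsRH
import Literature.NumberTheory.LFunctions.SelbergArchimedeanIntegralLong
import Literature.NumberTheory.LFunctions.ZetaZerosProofs
import HarnessLib

/-!
# Zeros of `ζ` in short intervals under RH, two-sided and on the full range `0 < h ≤ √t` (Balazard–de Roton 2008, Prop. 15)

Topic `Literature/NumberTheory/LFunctions`. Everything in this file is PROVED (no definitions, no
named facts). Label: **RH-CONDITIONAL** corpus literature — RH is the ANTECEDENT of the two main
theorems; nothing here bears on the truth of RH.

M. Balazard, A. de Roton, *Notes de lecture de l'article "Partial sums of the Möbius function" de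
K. Soundararajan*, arXiv:0810.3587, Prop. 15 (after A. Selberg and D. A. Goldston–S. M. Gonek,
*A note on S(t) and the zeros of the Riemann zeta-function*, Bull. LMS 39 (2007)):

> **Proposition 15 (HR).** Soit `t ≥ 4`, `Δ ≥ 2` et `0 < h ≤ √t`. On a
> `N(t+h) − N(t−h) − 2h (log t/2π)/(2π) ≤ log t/(2πΔ) − (1/π) Re Σ_{p ≤ e^{2πΔ}} (log p/p^{½+it}) F̂₊(log p/2π) + O(log Δ)`,
> et
> `N(t+h) − N(t−h) − 2h (log t/2π)/(2π) ≥ −log t/(2πΔ) − (1/π) Re Σ_{p ≤ e^{2πΔ}} (log p/p^{½+it}) F̂₋(log p/2π) + O(log Δ)`.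

The sibling file `ZetaZerosShortIntervalsRH.lean` proves the UPPER bound for `0 < h ≤ 1`. Here
BOTH bounds are proved on the full printed range `0 < h ≤ √t`, for `t ≥ 36` and under the same
harmless extra hypothesis `e^{πΔ} ≤ t` as there (which absorbs the polar terms `F±(±i/2 − t)`):
`Literature.NumberTheory.LFunctions.ShortIntervalsRHLong.zetaZeroCount_short_interval_le_of_RH_long`
and `…ge_of_RH_long`. The only new analytic input w.r.t. the sibling file is the archimedean
integral `∫ F±(u − t) Re ψ(¼ + iu/2) du = (2h ± 1/Δ) log(t/2) + O(1)` on the full range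
(`SelbergArchimedeanIntegralLong.lean`); the lower bound uses the minorant `F₋ ≤ 𝟙_{(−h,h)}` and
the domination `Σ_ρ m(ρ) F₋(γ_ρ − t) ≤ N(t+h) − N(t−h)` (`tsum_le_zetaZeroCount_sub`, where zeros
off the window contribute `≤ 0`), then the explicit formula
`Literature.NumberTheory.LFunctions.tsum_zeros_shift_eq_explicit` for `F₋(· − t)` exactly as for
`F₊`. "La démonstration de la minoration est analogue" (loc. cit.).

## References

* [BalazardDeRoton2008] M. Balazard, A. de Roton, arXiv:0810.3587, Prop. 15 (and Props. 10–12).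
  [cite: BalazardDeRoton2008, Prop. 15]
* D. A. Goldston, S. M. Gonek, Bull. LMS 39 (2007), 482–486, Lemma 1 and (2.3)–(2.4).
-/

noncomputable section

open Complex Filter Set MeasureTheory Topology Finset
open scoped Real FourierTransform

namespace Literature.NumberTheory.LFunctions

open Literature.Analysis.Fourier Literature.Analysis.SpecialFunctions ArithmeticFunction
open ShortIntervalsRH

namespace ShortIntervalsRHLong

open ChebyshevWeighted

/-! ## The zero sum of the minorant is dominated by the zero count -/

/-- **`Σ_ρ m(ρ) F₋(γ_ρ − t) ≤ N(t+h) − N(t−h)`** for Selberg's minorant `F₋` of `[−h, h]`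
(`F₋ ≤ 𝟙_{(−h,h)}`; zeros with ordinate outside `(t − h, t + h)` contribute `≤ 0`; `h < t`).
[cite: BalazardDeRoton2008, Prop. 15 (proof)] -/
theorem tsum_le_zetaZeroCount_sub {Δ t h : ℝ} (hΔ : 0 < Δ) (hh : 0 < h) (hht : h < t)
    (hsum : Summable fun ρ : ZetaZeros.riemannZetaNontrivialZeros ↦
      (riemannZetaZeroOrder (ρ : ℂ) : ℝ) * selbergMinorantReal Δ (-h) h ((ρ : ℂ).im - t)) :
    ∑' ρ : ZetaZeros.riemannZetaNontrivialZeros,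
        (riemannZetaZeroOrder (ρ : ℂ) : ℝ) * selbergMinorantReal Δ (-h) h ((ρ : ℂ).im - t) ≤
      ((zetaZeroCount (t + h) : ℝ) - zetaZeroCount (t - h)) := by
  classical
  have hiff : ∀ {ρ : ℂ}, ρ ∈ ZetaZeros.riemannZetaNontrivialZeros ↔
      riemannZeta ρ = 0 ∧ 0 < ρ.re ∧ ρ.re < 1 := mem_riemannZetaNontrivialZeros_iff_holds
  set D : Set ℂ := zetaZeroBox 0 (t + h) \ zetaZeroBox 0 (t - h) with hD
  have hDf : D.Finite := (zetaZeroBox_finite 0 (t + h)).subset Set.sdiff_subset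
  have hint : ((zetaZeroCount (t + h) : ℤ) - zetaZeroCount (t - h)) = ∑ᶠ ρ ∈ D, riemannZetaZeroOrder ρ :=
    Montgomery.zetaZeroCount_sub_eq_finsum (by linarith)
  rw [finsum_mem_eq_finite_toFinset_sum _ hDf] at hint
  have hDZ : ∀ ρ ∈ hDf.toFinset, ρ ∈ ZetaZeros.riemannZetaNontrivialZeros := fun ρ hρ ↦
    zetaZeroBox_subset_riemannZetaNontrivialZeros 0 (t + h) ((Set.Finite.mem_toFinset hDf).1 hρ).1
  set s : Finset ZetaZeros.riemannZetaNontrivialZeros :=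
    hDf.toFinset.subtype (· ∈ ZetaZeros.riemannZetaNontrivialZeros) with hs
  have hsumZ : ∑ ρ ∈ hDf.toFinset, (riemannZetaZeroOrder ρ : ℝ) =
      ∑ x ∈ s, (riemannZetaZeroOrder (x : ℂ) : ℝ) := by
    rw [hs, Finset.sum_subtype_of_mem (fun ρ : ℂ ↦ (riemannZetaZeroOrder ρ : ℝ)) hDZ]
  have hcast : ((zetaZeroCount (t + h) : ℝ) - zetaZeroCount (t - h)) =
      ∑ ρ ∈ hDf.toFinset, (riemannZetaZeroOrder ρ : ℝ) := by
    have := congrArg (fun z : ℤ ↦ (z : ℝ)) hint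
    push_cast at this
    exact this
  rw [hcast, hsumZ]
  have hm0 : ∀ x : ZetaZeros.riemannZetaNontrivialZeros, (0 : ℝ) ≤ riemannZetaZeroOrder (x : ℂ) := fun x ↦ by
    exact_mod_cast riemannZetaZeroOrder_nonneg (ZetaZeros.riemannZetaNontrivialZeros.ne_one x.2)
  -- membership in `s` is membership of the ordinate in `(t − h, t + h]`
  have hmem_of : ∀ x : ZetaZeros.riemannZetaNontrivialZeros,
      t - h < (x : ℂ).im → (x : ℂ).im ≤ t + h → x ∈ s := by
    intro x h1 h2
    obtain ⟨hz, hre0, hre1⟩ := hiff.1 x.2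
    rw [hs, Finset.mem_subtype, Set.Finite.mem_toFinset]
    refine ⟨⟨hz, hre0.le, hre1.le, by linarith, h2⟩, ?_⟩
    rintro ⟨-, -, -, -, h5⟩
    linarith
  -- pointwise: `m(x) F₋(γ − t) ≤ m(x)` on `s`, `≤ 0` off `s`
  set f : ZetaZeros.riemannZetaNontrivialZeros → ℝ := fun x ↦
    (riemannZetaZeroOrder (x : ℂ) : ℝ) * selbergMinorantReal Δ (-h) h ((x : ℂ).im - t) with hf
  have hpt : ∀ x : ZetaZeros.riemannZetaNontrivialZeros,
      f x ≤ if x ∈ s then (riemannZetaZeroOrder (x : ℂ) : ℝ) else 0 := by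
    intro x
    have hle := selbergMinorantReal_le_indicator hΔ (-h) h ((x : ℂ).im - t)
    by_cases hx : x ∈ s
    · rw [if_pos hx]
      have h1 : selbergMinorantReal Δ (-h) h ((x : ℂ).im - t) ≤ 1 :=
        hle.trans (Set.indicator_le_self' (fun _ _ ↦ zero_le_one) _)
      calc f x ≤ (riemannZetaZeroOrder (x : ℂ) : ℝ) * 1 := mul_le_mul_of_nonneg_left h1 (hm0 x)
        _ = _ := mul_one _
    · rw [if_neg hx]
      have hnot : (x : ℂ).im - t ∉ Ioo (-h) h := by
        rintro ⟨h1, h2⟩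
        exact hx (hmem_of x (by linarith) (by linarith))
      have h1 : selbergMinorantReal Δ (-h) h ((x : ℂ).im - t) ≤ 0 := by
        have := hle; rwa [Set.indicator_of_notMem hnot] at this
      exact mul_nonpos_iff.2 (Or.inl ⟨hm0 x, h1⟩)
  refine hsum.tsum_le_of_sum_le fun T ↦ ?_
  calc ∑ x ∈ T, f x ≤ ∑ x ∈ T, (if x ∈ s then (riemannZetaZeroOrder (x : ℂ) : ℝ) else 0) :=
        Finset.sum_le_sum fun x _ ↦ hpt x
    _ = ∑ x ∈ T.filter (· ∈ s), (riemannZetaZeroOrder (x : ℂ) : ℝ) := (Finset.sum_filter _ _).symm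
    _ ≤ ∑ x ∈ s, (riemannZetaZeroOrder (x : ℂ) : ℝ) :=
        Finset.sum_le_sum_of_subset_of_nonneg (fun x hx ↦ (Finset.mem_filter.1 hx).2)
          fun x _ _ ↦ hm0 x

/-! ## Polar terms for a long window -/

/-- The polar terms are `≤ 1`: `‖F₊(±i/2 − t)‖ ≤ 1` when `e^{πΔ} ≤ t`, `t ≥ 4`, `Δ ≥ 2`, `h ≤ t/4`.
[cite: BalazardDeRoton2008, Prop. 15 (proof)] -/
theorem norm_selbergMajorant_polar_le_long {Δ t h : ℝ} (ht : 4 ≤ t) (hΔ : 2 ≤ Δ)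
    (hexp : Real.exp (π * Δ) ≤ t) (hh0 : 0 < h) (hh1 : h ≤ t / 4) (s : ℝ) (hs : s = 1 ∨ s = -1) :
    ‖selbergMajorant Δ (-h) h ((s : ℂ) * (I / 2) - t)‖ ≤ 1 := by
  have hΔ0 : 0 < Δ := by linarith
  have hmin : min (-h) h = -h := min_eq_left (by linarith)
  have h1Δ : 1 / Δ ≤ 1 / 2 := by
    rw [div_le_div_iff₀ hΔ0 (by norm_num)]; linarith
  set z : ℂ := (s : ℂ) * (I / 2) - t with hz
  have hzre : z.re = -t := by rcases hs with rfl | rfl <;> simp [hz]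
  have hzim : |z.im| = 1 / 2 := by
    rcases hs with rfl | rfl <;> simp [hz]
  have hcond : z.re ≤ min (-h) h - 1 / Δ := by rw [hzre, hmin]; linarith
  have hb := norm_selbergMajorant_le_of_re_le (a := -h) (b := h) hΔ0 hcond
  rw [hzim, hmin, hzre] at hb
  refine hb.trans ?_
  have hexp' : Real.exp (2 * π * Δ * (1 / 2)) ≤ t := by
    rw [show 2 * π * Δ * (1 / 2) = π * Δ by ring]; exact hexp
  have htpos : 0 < t := by linarith
  have hpos : 0 < -h - -t := by linarith
  have hth : (3 / 4 * t) ^ 2 ≤ (-h - -t) ^ 2 := by nlinarith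
  have hΔ2 : 4 ≤ Δ ^ 2 := by nlinarith
  rw [div_le_one (by positivity)]
  calc 3 / 2 * Real.exp (2 * π * Δ * (1 / 2)) ≤ 3 / 2 * t := by gcongr
    _ ≤ 4 * (3 / 4 * t) ^ 2 := by nlinarith
    _ ≤ Δ ^ 2 * (3 / 4 * t) ^ 2 := by gcongr
    _ ≤ Δ ^ 2 * (-h - -t) ^ 2 := by gcongr

/-- The polar terms are `≤ 1`: `‖F₋(±i/2 − t)‖ ≤ 1` when `e^{πΔ} ≤ t`, `t ≥ 4`, `Δ ≥ 2`, `h ≤ t/4`.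
[cite: BalazardDeRoton2008, Prop. 15 (proof)] -/
theorem norm_selbergMinorant_polar_le_long {Δ t h : ℝ} (ht : 4 ≤ t) (hΔ : 2 ≤ Δ)
    (hexp : Real.exp (π * Δ) ≤ t) (hh0 : 0 < h) (hh1 : h ≤ t / 4) (s : ℝ) (hs : s = 1 ∨ s = -1) :
    ‖selbergMinorant Δ (-h) h ((s : ℂ) * (I / 2) - t)‖ ≤ 1 := by
  have hΔ0 : 0 < Δ := by linarith
  have hmin : min (-h) h = -h := min_eq_left (by linarith)
  have h1Δ : 1 / Δ ≤ 1 / 2 := by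
    rw [div_le_div_iff₀ hΔ0 (by norm_num)]; linarith
  set z : ℂ := (s : ℂ) * (I / 2) - t with hz
  have hzre : z.re = -t := by rcases hs with rfl | rfl <;> simp [hz]
  have hzim : |z.im| = 1 / 2 := by
    rcases hs with rfl | rfl <;> simp [hz]
  have hcond : z.re ≤ min (-h) h - 1 / Δ := by rw [hzre, hmin]; linarith
  have hb := norm_selbergMinorant_le_of_re_le (a := -h) (b := h) hΔ0 hcond
  rw [hzim, hmin, hzre] at hb
  refine hb.trans ?_
  have hexp' : Real.exp (2 * π * Δ * (1 / 2)) ≤ t := by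
    rw [show 2 * π * Δ * (1 / 2) = π * Δ by ring]; exact hexp
  have htpos : 0 < t := by linarith
  have hpos : 0 < -h - -t := by linarith
  have hth : (3 / 4 * t) ^ 2 ≤ (-h - -t) ^ 2 := by nlinarith
  have hΔ2 : 4 ≤ Δ ^ 2 := by nlinarith
  rw [div_le_one (by positivity)]
  calc 3 / 2 * Real.exp (2 * π * Δ * (1 / 2)) ≤ 3 / 2 * t := by gcongr
    _ ≤ 4 * (3 / 4 * t) ^ 2 := by nlinarith
    _ ≤ Δ ^ 2 * (3 / 4 * t) ^ 2 := by gcongr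
    _ ≤ Δ ^ 2 * (-h - -t) ^ 2 := by gcongr

/-- The `n`-th prime-side term of the explicit formula for `F₋(· − t)` is the real number
`Λ(n) n^{−½} (1/π) F̂₋(log n/2π) cos(t log n)` (`F̂₋` real and even).
[cite: BalazardDeRoton2008, Prop. 15 (proof)] -/
theorem primeTerm_minorant_eq_ofReal (Δ h t : ℝ) (n : ℕ) :
    ((vonMangoldt n : ℝ) : ℂ) / (Real.sqrt n : ℂ) *
      ((1 / (2 * π) : ℂ) * (Complex.exp (-(t * Real.log n) * I) *
        𝓕 (fun x : ℝ ↦ selbergMinorant Δ (-h) h x) (Real.log n / (2 * π))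
        + Complex.exp ((t * Real.log n) * I) *
          𝓕 (fun x : ℝ ↦ selbergMinorant Δ (-h) h x) (-(Real.log n / (2 * π))))) =
      (((vonMangoldt n : ℝ) / Real.sqrt n * (1 / π *
        (𝓕 (fun x : ℝ ↦ selbergMinorant Δ (-h) h x) (Real.log n / (2 * π))).re *
          Real.cos (t * Real.log n)) : ℝ) : ℂ) := by
  set ξ : ℝ := Real.log n / (2 * π) with hξ
  set c : ℝ := Real.cos (t * Real.log n) with hc
  have heven : 𝓕 (fun x : ℝ ↦ selbergMinorant Δ (-h) h x) (-ξ) = 𝓕 (fun x : ℝ ↦ selbergMinorant Δ (-h) h x) ξ :=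
    fourier_selbergMinorant_symm_neg Δ h ξ
  have hreal : 𝓕 (fun x : ℝ ↦ selbergMinorant Δ (-h) h x) ξ =
      (((𝓕 (fun x : ℝ ↦ selbergMinorant Δ (-h) h x) ξ).re : ℝ) : ℂ) := by
    apply Complex.ext
    · simp
    · simp [fourier_selbergMinorant_symm_im Δ h ξ]
  set wr : ℝ := (𝓕 (fun x : ℝ ↦ selbergMinorant Δ (-h) h x) ξ).re with hwr
  rw [heven, hreal]
  have hcos : Complex.exp (-(t * Real.log n) * I) + Complex.exp ((t * Real.log n) * I) = 2 * (c : ℂ) := by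
    rw [hc, Complex.ofReal_cos, Complex.two_cos]
    push_cast
    ring_nf
  have hπ : (π : ℂ) ≠ 0 := Complex.ofReal_ne_zero.2 Real.pi_ne_zero
  rw [show Complex.exp (-(t * Real.log n) * I) * (wr : ℂ) + Complex.exp ((t * Real.log n) * I) * (wr : ℂ) =
    (Complex.exp (-(t * Real.log n) * I) + Complex.exp ((t * Real.log n) * I)) * (wr : ℂ) by ring, hcos]
  push_cast
  field_simp

/-! ## Elementary facts about the range `t ≥ 36` -/

/-- `√t ≤ t/6` for `t ≥ 36`. [folklore] -/
private theorem sqrt_le_div_six {t : ℝ} (ht : 36 ≤ t) : Real.sqrt t ≤ t / 6 := by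
  rw [Real.sqrt_le_left (by positivity)]; nlinarith

/-! ## The upper bound on the full range -/

set_option maxHeartbeats 800000 in
/-- **Balazard–de Roton 2008, Prop. 15 (upper bound), under RH, full range `0 < h ≤ √t`**
(`t ≥ 36`, `Δ ≥ 2`, with the harmless extra hypothesis `e^{πΔ} ≤ t`): with an absolute constant
`C`, `N(t+h) − N(t−h) − 2h log(t/2π)/(2π) ≤ log t/(2πΔ) − (1/π) Σ_{p ≤ e^{2πΔ}} (log p/√p) F̂₊(log p/2π) cos(t log p) + C log Δ`.
[cite: BalazardDeRoton2008, Prop. 15] -/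
theorem zetaZeroCount_short_interval_le_of_RH_long (hRH : RiemannHypothesis) :
    ∃ C : ℝ, ∀ t Δ h : ℝ, 36 ≤ t → 2 ≤ Δ → Real.exp (π * Δ) ≤ t → 0 < h → h ≤ Real.sqrt t →
      ((zetaZeroCount (t + h) : ℝ) - zetaZeroCount (t - h)) - 2 * h * Real.log (t / (2 * π)) / (2 * π) ≤
        Real.log t / (2 * π * Δ)
        - (1 / π) * ∑ p ∈ (Finset.Ioc 0 ⌊Real.exp (2 * π * Δ)⌋₊).filter Nat.Prime,
            Real.log p / Real.sqrt p *
              (𝓕 (fun x : ℝ ↦ selbergMajorant Δ (-h) h x) (Real.log p / (2 * π))).re * Real.cos (t * Real.log p)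
        + C * Real.log Δ := by
  obtain ⟨C_E, hCE⟩ := exists_abs_integral_selbergMajorant_reDigammaQuarter_sub_le_long
  set B₀ : ℝ := |C_E| / (2 * π) + 2 + 14 * (Real.log (2 * π) + 4) with hB₀
  have hB₀pos : 0 ≤ B₀ := by
    have : 0 ≤ Real.log (2 * π) := Real.log_nonneg (by nlinarith [Real.pi_gt_three])
    positivity
  have hlog2 : 0 < Real.log 2 := Real.log_pos (by norm_num)
  refine ⟨14 + B₀ / Real.log 2, fun t Δ h ht hΔ hexp hh0 hh1 ↦ ?_⟩
  have ht4 : 4 ≤ t := by linarith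
  have hΔ0 : 0 < Δ := by linarith
  have hΔ1 : 1 ≤ Δ := by linarith
  have hab : -h ≤ h := by linarith
  have htpos : 0 < t := by linarith
  have hht4 : h ≤ t / 4 := by linarith [hh1.trans (sqrt_le_div_six ht)]
  have hlogΔ : Real.log 2 ≤ Real.log Δ := Real.log_le_log (by norm_num) hΔ
  set F : ℂ → ℂ := selbergMajorant Δ (-h) h with hFdef
  obtain ⟨K, hK, hb⟩ := exists_norm_selbergMajorant_le hΔ0 (-h) h
  have hsupp : ∀ ξ : ℝ, Δ ≤ |ξ| → 𝓕 (fun x : ℝ ↦ F x) ξ = 0 := fun ξ hξ ↦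
    fourier_selbergMajorant_eq_zero hΔ0 hab hξ
  have hFreal : ∀ u : ℝ, F ((u : ℝ) : ℂ) = (selbergMajorantReal Δ (-h) h u : ℂ) := fun u ↦
    selbergMajorant_ofReal Δ (-h) h u
  have hAreal := integrable_selbergMajorant_shift_mul_reDigammaQuarter_long (t := t) hΔ1 ht hh0 hh1
  have hA : Integrable fun u : ℝ ↦ F ((u - t : ℝ) : ℂ) * (reDigammaQuarter u : ℂ) := by
    refine (Complex.ofRealCLM.integrable_comp hAreal).congr (Eventually.of_forall fun u ↦ ?_)
    simp only [Complex.ofRealCLM_apply, Complex.ofReal_mul, hFreal]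
  obtain ⟨hZs, hEqn⟩ := tsum_zeros_shift_eq_explicit hRH hΔ0 (differentiable_selbergMajorant Δ (-h) h)
    hK.le hb hsupp hA
  -- (1) the left-hand side is real and dominates the zero count
  have hterm : ∀ ρ : ZetaZeros.riemannZetaNontrivialZeros,
      (riemannZetaZeroOrder (ρ : ℂ) : ℂ) * F ((((ρ : ℂ).im - t : ℝ)) : ℂ) =
        (((riemannZetaZeroOrder (ρ : ℂ) : ℝ) * selbergMajorantReal Δ (-h) h ((ρ : ℂ).im - t) : ℝ) : ℂ) := by
    intro ρ; rw [hFreal]; push_cast; ring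
  have hZs' : Summable fun ρ : ZetaZeros.riemannZetaNontrivialZeros ↦
      (riemannZetaZeroOrder (ρ : ℂ) : ℝ) * selbergMajorantReal Δ (-h) h ((ρ : ℂ).im - t) := by
    have h1 : Summable fun ρ : ZetaZeros.riemannZetaNontrivialZeros ↦
        |(riemannZetaZeroOrder (ρ : ℂ) : ℝ) * selbergMajorantReal Δ (-h) h ((ρ : ℂ).im - t)| := by
      refine hZs.congr fun ρ ↦ ?_
      rw [hterm, Complex.norm_real, Real.norm_eq_abs]
    exact h1.of_abs
  set Zr : ℝ := ∑' ρ : ZetaZeros.riemannZetaNontrivialZeros,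
    (riemannZetaZeroOrder (ρ : ℂ) : ℝ) * selbergMajorantReal Δ (-h) h ((ρ : ℂ).im - t) with hZr
  have hLHS : ∑' ρ : ZetaZeros.riemannZetaNontrivialZeros,
      (riemannZetaZeroOrder (ρ : ℂ) : ℂ) * F ((((ρ : ℂ).im - t : ℝ)) : ℂ) = (Zr : ℂ) := by
    rw [hZr, Complex.ofReal_tsum]
    exact tsum_congr hterm
  have hcount := zetaZeroCount_sub_le_tsum (t := t) hΔ0 hh0 hZs'
  -- (2) the prime side as a real finite sum
  set N : ℕ := ⌊Real.exp (2 * π * Δ)⌋₊ with hN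
  set w : ℝ → ℝ := fun ξ ↦ (𝓕 (fun x : ℝ ↦ F x) ξ).re with hw
  set term : ℕ → ℝ := fun n ↦ (vonMangoldt n : ℝ) / Real.sqrt n * (1 / π * w (Real.log n / (2 * π)) *
    Real.cos (t * Real.log n)) with htermdef
  have hS : ∑' n : ℕ, ((vonMangoldt n : ℝ) : ℂ) / (Real.sqrt n : ℂ) *
      ((1 / (2 * π) : ℂ) * (Complex.exp (-(t * Real.log n) * I) * 𝓕 (fun x : ℝ ↦ F x) (Real.log n / (2 * π))
        + Complex.exp ((t * Real.log n) * I) * 𝓕 (fun x : ℝ ↦ F x) (-(Real.log n / (2 * π))))) =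
      ((∑ n ∈ Finset.Ioc 0 N, term n : ℝ) : ℂ) := by
    rw [tsum_eq_sum (s := Finset.Ioc 0 N)]
    · rw [Complex.ofReal_sum]
      refine Finset.sum_congr rfl fun n _ ↦ ?_
      simp only [htermdef, hw, hFdef]
      exact primeTerm_eq_ofReal Δ h t n
    · intro n hn
      rw [Finset.mem_Ioc, not_and_or, not_lt, not_le] at hn
      rcases hn with hn | hn
      · have : n = 0 := by omega
        subst this; simp
      · -- `n > e^{2πΔ}`: both Fourier values vanish
        have hn1 : Real.exp (2 * π * Δ) < n := by
          have := Nat.lt_floor_add_one (Real.exp (2 * π * Δ))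
          rw [← hN] at this
          exact this.trans_le (by exact_mod_cast hn)
        have hnpos : (0 : ℝ) < n := (Real.exp_pos _).trans hn1
        have hξ : Δ ≤ |Real.log n / (2 * π)| := by
          rw [abs_of_pos (div_pos (Real.log_pos (by
            have : (1 : ℝ) < Real.exp (2 * π * Δ) := by
              have : (0:ℝ) < 2 * π * Δ := by positivity
              exact Real.one_lt_exp_iff.2 this
            linarith)) (by positivity))]
          rw [le_div_iff₀ (by positivity), ← Real.log_exp (Δ * (2 * π))]
          refine Real.log_le_log (Real.exp_pos _) ?_
          rw [show Δ * (2 * π) = 2 * π * Δ by ring]; exact hn1.le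
        have hξ' : Δ ≤ |-(Real.log n / (2 * π))| := by rwa [abs_neg]
        rw [hsupp _ hξ, hsupp _ hξ']
        simp
  -- split the finite sum: primes / proper prime powers / the rest
  have hsplit : ∑ n ∈ Finset.Ioc 0 N, term n =
      ∑ p ∈ (Finset.Ioc 0 N).filter Nat.Prime, term p +
        ∑ n ∈ (Finset.Ioc 0 N).filter (fun n ↦ IsPrimePow n ∧ ¬ n.Prime), term n := by
    rw [← Finset.sum_filter_add_sum_filter_not (Finset.Ioc 0 N) Nat.Prime term]
    congr 1
    rw [← Finset.sum_filter_add_sum_filter_not ((Finset.Ioc 0 N).filter (fun n ↦ ¬ n.Prime)) IsPrimePow term]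
    have hzero : ∑ n ∈ ((Finset.Ioc 0 N).filter (fun n ↦ ¬ n.Prime)).filter (fun n ↦ ¬ IsPrimePow n), term n = 0 := by
      refine Finset.sum_eq_zero fun n hn ↦ ?_
      rw [Finset.mem_filter] at hn
      simp only [htermdef, ArithmeticFunction.vonMangoldt_eq_zero_iff.2 hn.2, zero_div, zero_mul]
    rw [hzero, add_zero, Finset.filter_filter]
    refine Finset.sum_congr ?_ fun _ _ ↦ rfl
    ext n; simp only [Finset.mem_filter]; tauto
  have hprimes : ∑ p ∈ (Finset.Ioc 0 N).filter Nat.Prime, term p =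
      (1 / π) * ∑ p ∈ (Finset.Ioc 0 N).filter Nat.Prime,
        Real.log p / Real.sqrt p * w (Real.log p / (2 * π)) * Real.cos (t * Real.log p) := by
    rw [Finset.mul_sum]
    refine Finset.sum_congr rfl fun p hp ↦ ?_
    rw [Finset.mem_filter] at hp
    simp only [htermdef, ArithmeticFunction.vonMangoldt_apply_prime hp.2]
    ring
  have hpp : |∑ n ∈ (Finset.Ioc 0 N).filter (fun n ↦ IsPrimePow n ∧ ¬ n.Prime), term n| ≤
      14 * (Real.log Δ + Real.log (2 * π) + 4) := by
    refine (Finset.abs_sum_le_sum_abs _ _).trans ?_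
    have hle : ∀ n ∈ (Finset.Ioc 0 N).filter (fun n ↦ IsPrimePow n ∧ ¬ n.Prime), |term n| ≤ 4 * (1 / Real.sqrt n) := by
      intro n hn
      rw [Finset.mem_filter] at hn
      have hn2 : 2 ≤ n := hn.2.1.two_le
      have hnpos : (0 : ℝ) < n := by exact_mod_cast (by omega : 0 < n)
      have h4 := abs_log_mul_re_fourier_selbergMajorant_le hΔ0 hh0.le hn2
      have hΛ : (vonMangoldt n : ℝ) ≤ Real.log n := ArithmeticFunction.vonMangoldt_le_log
      have hΛ0 : (0 : ℝ) ≤ vonMangoldt n := ArithmeticFunction.vonMangoldt_nonneg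
      have hlogpos : 0 < Real.log n := Real.log_pos (by exact_mod_cast hn2)
      simp only [htermdef, hw, hFdef]
      rw [abs_mul, abs_div, abs_of_nonneg hΛ0, abs_of_pos (Real.sqrt_pos.2 hnpos)]
      have hcos : |Real.cos (t * Real.log n)| ≤ 1 := Real.abs_cos_le_one _
      have hkey : |1 / π * (𝓕 (fun x : ℝ ↦ selbergMajorant Δ (-h) h x) (Real.log n / (2 * π))).re *
          Real.cos (t * Real.log n)| ≤ 4 / Real.log n := by
        rw [abs_mul]
        have h5 : |1 / π * (𝓕 (fun x : ℝ ↦ selbergMajorant Δ (-h) h x) (Real.log n / (2 * π))).re| ≤ 4 / Real.log n := by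
          rw [le_div_iff₀ hlogpos]
          calc |1 / π * (𝓕 (fun x : ℝ ↦ selbergMajorant Δ (-h) h x) (Real.log n / (2 * π))).re| * Real.log n
              = |Real.log n / π * (𝓕 (fun x : ℝ ↦ selbergMajorant Δ (-h) h x) (Real.log n / (2 * π))).re| := by
                rw [abs_mul, abs_mul, abs_of_pos (by positivity : (0 : ℝ) < 1 / π),
                  abs_of_pos (by positivity : (0 : ℝ) < Real.log n / π)]
                ring
            _ ≤ 4 := h4
        calc |1 / π * (𝓕 (fun x : ℝ ↦ selbergMajorant Δ (-h) h x) (Real.log n / (2 * π))).re| *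
              |Real.cos (t * Real.log n)| ≤ 4 / Real.log n * 1 := by
              gcongr
          _ = 4 / Real.log n := mul_one _
      calc (vonMangoldt n : ℝ) / Real.sqrt n *
            |1 / π * (𝓕 (fun x : ℝ ↦ selbergMajorant Δ (-h) h x) (Real.log n / (2 * π))).re * Real.cos (t * Real.log n)|
          ≤ Real.log n / Real.sqrt n * (4 / Real.log n) := by gcongr
        _ = 4 * (1 / Real.sqrt n) := by field_simp
    calc ∑ n ∈ (Finset.Ioc 0 N).filter (fun n ↦ IsPrimePow n ∧ ¬ n.Prime), |term n|
        ≤ ∑ n ∈ (Finset.Ioc 0 N).filter (fun n ↦ IsPrimePow n ∧ ¬ n.Prime), 4 * (1 / Real.sqrt n) :=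
          Finset.sum_le_sum hle
      _ = 4 * ∑ n ∈ (Finset.Ioc 0 N).filter (fun n ↦ IsPrimePow n ∧ ¬ n.Prime), (1 / Real.sqrt n : ℝ) := by
          rw [Finset.mul_sum]
      _ ≤ 4 * ((7 / 2) * ∑ p ∈ (Finset.Ioc 0 N).filter Nat.Prime, (1 / p : ℝ)) := by
          gcongr
          have hX : (2 : ℝ) ≤ Real.exp (2 * π * Δ) := by
            have : (2 : ℝ) ≤ 2 * π * Δ + 1 := by nlinarith [Real.pi_gt_three]
            exact this.trans (Real.add_one_le_exp _)
          exact sum_properPrimePow_inv_sqrt_le hX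
      _ ≤ 4 * ((7 / 2) * (Real.log Δ + Real.log (2 * π) + 4)) := by
          gcongr
          exact sum_inv_prime_le_log Δ hΔ1
      _ = 14 * (Real.log Δ + Real.log (2 * π) + 4) := by ring
  -- (3) the archimedean side is real and bounded
  have hF0 : 𝓕 (fun x : ℝ ↦ F x) 0 = ((2 * h + 1 / Δ : ℝ) : ℂ) := by
    rw [hFdef, fourier_selbergMajorant_zero hΔ0 hab]
    congr 1; ring
  have hIint : (∫ u : ℝ, F ((u - t : ℝ) : ℂ) * (reDigammaQuarter u : ℂ)) =
      ((∫ u : ℝ, selbergMajorantReal Δ (-h) h (u - t) * reDigammaQuarter u : ℝ) : ℂ) := by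
    rw [← integral_complex_ofReal]
    refine integral_congr_ae (Eventually.of_forall fun u ↦ ?_)
    simp only [hFreal, Complex.ofReal_mul]
  set Ir : ℝ := ∫ u : ℝ, selbergMajorantReal Δ (-h) h (u - t) * reDigammaQuarter u with hIr
  have hIr : Ir ≤ (2 * h + 1 / Δ) * Real.log (t / 2) + |C_E| := by
    have := hCE Δ t h hΔ1 ht hh0 hh1
    have h2 := (abs_le.1 this).2
    linarith [le_abs_self C_E]
  have hArch : ((1 / (2 * π) : ℂ) * (∫ u : ℝ, F ((u - t : ℝ) : ℂ) * (reDigammaQuarter u : ℂ))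
      - (1 / (2 * π) : ℂ) * 𝓕 (fun x : ℝ ↦ F x) 0 * (Real.log π : ℂ)) =
      ((1 / (2 * π) * (Ir - (2 * h + 1 / Δ) * Real.log π) : ℝ) : ℂ) := by
    rw [hIint, hF0]; push_cast; ring
  have hArch_le : 1 / (2 * π) * (Ir - (2 * h + 1 / Δ) * Real.log π) ≤
      2 * h * Real.log (t / (2 * π)) / (2 * π) + Real.log t / (2 * π * Δ) + |C_E| / (2 * π) := by
    have hlogsplit : Real.log (t / 2) - Real.log π = Real.log (t / (2 * π)) := by
      rw [← Real.log_div (by positivity) Real.pi_ne_zero]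
      congr 1; field_simp
    have h1 : Ir - (2 * h + 1 / Δ) * Real.log π ≤ (2 * h + 1 / Δ) * Real.log (t / (2 * π)) + |C_E| := by
      rw [← hlogsplit]; nlinarith
    have h2 : (1 / Δ) * Real.log (t / (2 * π)) ≤ (1 / Δ) * Real.log t := by
      refine mul_le_mul_of_nonneg_left (Real.log_le_log (by positivity) ?_) (by positivity)
      rw [div_le_iff₀ (by positivity)]; nlinarith [Real.pi_gt_three]
    have hπ2 : (0 : ℝ) < 1 / (2 * π) := by positivity
    calc 1 / (2 * π) * (Ir - (2 * h + 1 / Δ) * Real.log π)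
        ≤ 1 / (2 * π) * ((2 * h + 1 / Δ) * Real.log (t / (2 * π)) + |C_E|) :=
          mul_le_mul_of_nonneg_left h1 hπ2.le
      _ = 2 * h * Real.log (t / (2 * π)) / (2 * π) + 1 / (2 * π) * ((1 / Δ) * Real.log (t / (2 * π))) +
            |C_E| / (2 * π) := by ring
      _ ≤ 2 * h * Real.log (t / (2 * π)) / (2 * π) + 1 / (2 * π) * ((1 / Δ) * Real.log t) + |C_E| / (2 * π) := by
          gcongr
      _ = _ := by field_simp
  -- (4) the polar side
  have hP : (selbergMajorant Δ (-h) h (I / 2 - t)).re + (selbergMajorant Δ (-h) h (-(I / 2) - t)).re ≤ 2 := by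
    have h1 := norm_selbergMajorant_polar_le_long (Δ := Δ) (t := t) ht4 hΔ hexp hh0 hht4 1 (Or.inl rfl)
    have h2 := norm_selbergMajorant_polar_le_long (Δ := Δ) (t := t) ht4 hΔ hexp hh0 hht4 (-1) (Or.inr rfl)
    simp only [Complex.ofReal_one, one_mul, Complex.ofReal_neg, neg_one_mul] at h1 h2
    have h3 := (Complex.re_le_norm (selbergMajorant Δ (-h) h (I / 2 - t))).trans h1
    have h4 := (Complex.re_le_norm (selbergMajorant Δ (-h) h (-(I / 2) - t))).trans h2
    linarith
  -- (5) assemble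
  rw [hLHS, hS, hArch] at hEqn
  have hre := congrArg Complex.re hEqn
  simp only [Complex.ofReal_re, Complex.sub_re, Complex.add_re] at hre
  rw [hsplit, hprimes] at hre
  have hpp' := (abs_le.1 hpp).1
  have hfinal : Zr ≤ 2 - (1 / π) * ∑ p ∈ (Finset.Ioc 0 N).filter Nat.Prime,
        Real.log p / Real.sqrt p * w (Real.log p / (2 * π)) * Real.cos (t * Real.log p)
      + 14 * (Real.log Δ + Real.log (2 * π) + 4)
      + (2 * h * Real.log (t / (2 * π)) / (2 * π) + Real.log t / (2 * π * Δ) + |C_E| / (2 * π)) := by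
    linarith
  have hCbound : 2 + 14 * (Real.log (2 * π) + 4) + |C_E| / (2 * π) ≤ (B₀ / Real.log 2) * Real.log Δ := by
    rw [div_mul_eq_mul_div, le_div_iff₀ hlog2]
    have : 2 + 14 * (Real.log (2 * π) + 4) + |C_E| / (2 * π) = B₀ := by rw [hB₀]; ring
    rw [this]
    nlinarith
  calc ((zetaZeroCount (t + h) : ℝ) - zetaZeroCount (t - h)) - 2 * h * Real.log (t / (2 * π)) / (2 * π)
      ≤ Zr - 2 * h * Real.log (t / (2 * π)) / (2 * π) := by linarith
    _ ≤ Real.log t / (2 * π * Δ)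
        - (1 / π) * ∑ p ∈ (Finset.Ioc 0 N).filter Nat.Prime,
            Real.log p / Real.sqrt p * w (Real.log p / (2 * π)) * Real.cos (t * Real.log p)
        + (14 + B₀ / Real.log 2) * Real.log Δ := by nlinarith

/-! ## The lower bound on the full range -/

set_option maxHeartbeats 800000 in
/-- **Balazard–de Roton 2008, Prop. 15 (lower bound), under RH, full range `0 < h ≤ √t`**
(`t ≥ 36`, `Δ ≥ 2`, with the harmless extra hypothesis `e^{πΔ} ≤ t`): with an absolute constant
`C`, `N(t+h) − N(t−h) − 2h log(t/2π)/(2π) ≥ −log t/(2πΔ) − (1/π) Σ_{p ≤ e^{2πΔ}} (log p/√p) F̂₋(log p/2π) cos(t log p) − C log Δ`.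
[cite: BalazardDeRoton2008, Prop. 15] -/
theorem zetaZeroCount_short_interval_ge_of_RH_long (hRH : RiemannHypothesis) :
    ∃ C : ℝ, ∀ t Δ h : ℝ, 36 ≤ t → 2 ≤ Δ → Real.exp (π * Δ) ≤ t → 0 < h → h ≤ Real.sqrt t →
      -(Real.log t / (2 * π * Δ))
        - (1 / π) * ∑ p ∈ (Finset.Ioc 0 ⌊Real.exp (2 * π * Δ)⌋₊).filter Nat.Prime,
            Real.log p / Real.sqrt p *
              (𝓕 (fun x : ℝ ↦ selbergMinorant Δ (-h) h x) (Real.log p / (2 * π))).re * Real.cos (t * Real.log p)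
        - C * Real.log Δ ≤
      ((zetaZeroCount (t + h) : ℝ) - zetaZeroCount (t - h)) - 2 * h * Real.log (t / (2 * π)) / (2 * π) := by
  obtain ⟨C_E, hCE⟩ := exists_abs_integral_selbergMinorant_reDigammaQuarter_sub_le_long
  set B₀ : ℝ := |C_E| / (2 * π) + 2 + 14 * (Real.log (2 * π) + 4) with hB₀
  have hB₀pos : 0 ≤ B₀ := by
    have : 0 ≤ Real.log (2 * π) := Real.log_nonneg (by nlinarith [Real.pi_gt_three])
    positivity
  have hlog2 : 0 < Real.log 2 := Real.log_pos (by norm_num)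
  refine ⟨14 + B₀ / Real.log 2, fun t Δ h ht hΔ hexp hh0 hh1 ↦ ?_⟩
  have ht4 : 4 ≤ t := by linarith
  have hΔ0 : 0 < Δ := by linarith
  have hΔ1 : 1 ≤ Δ := by linarith
  have hab : -h ≤ h := by linarith
  have htpos : 0 < t := by linarith
  have hht4 : h ≤ t / 4 := by linarith [hh1.trans (sqrt_le_div_six ht)]
  have hht : h < t := by linarith
  have hlogΔ : Real.log 2 ≤ Real.log Δ := Real.log_le_log (by norm_num) hΔ
  set F : ℂ → ℂ := selbergMinorant Δ (-h) h with hFdef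
  obtain ⟨K, hK, hb⟩ := exists_norm_selbergMinorant_le hΔ0 (-h) h
  have hsupp : ∀ ξ : ℝ, Δ ≤ |ξ| → 𝓕 (fun x : ℝ ↦ F x) ξ = 0 := fun ξ hξ ↦
    fourier_selbergMinorant_eq_zero hΔ0 hab hξ
  have hFreal : ∀ u : ℝ, F ((u : ℝ) : ℂ) = (selbergMinorantReal Δ (-h) h u : ℂ) := fun u ↦
    selbergMinorant_ofReal Δ (-h) h u
  have hAreal := integrable_selbergMinorant_shift_mul_reDigammaQuarter_long (t := t) hΔ1 ht hh0 hh1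
  have hA : Integrable fun u : ℝ ↦ F ((u - t : ℝ) : ℂ) * (reDigammaQuarter u : ℂ) := by
    refine (Complex.ofRealCLM.integrable_comp hAreal).congr (Eventually.of_forall fun u ↦ ?_)
    simp only [Complex.ofRealCLM_apply, Complex.ofReal_mul, hFreal]
  obtain ⟨hZs, hEqn⟩ := tsum_zeros_shift_eq_explicit hRH hΔ0 (differentiable_selbergMinorant Δ (-h) h)
    hK.le hb hsupp hA
  -- (1) the left-hand side is real and is dominated by the zero count
  have hterm : ∀ ρ : ZetaZeros.riemannZetaNontrivialZeros,
      (riemannZetaZeroOrder (ρ : ℂ) : ℂ) * F ((((ρ : ℂ).im - t : ℝ)) : ℂ) =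
        (((riemannZetaZeroOrder (ρ : ℂ) : ℝ) * selbergMinorantReal Δ (-h) h ((ρ : ℂ).im - t) : ℝ) : ℂ) := by
    intro ρ; rw [hFreal]; push_cast; ring
  have hZs' : Summable fun ρ : ZetaZeros.riemannZetaNontrivialZeros ↦
      (riemannZetaZeroOrder (ρ : ℂ) : ℝ) * selbergMinorantReal Δ (-h) h ((ρ : ℂ).im - t) := by
    have h1 : Summable fun ρ : ZetaZeros.riemannZetaNontrivialZeros ↦
        |(riemannZetaZeroOrder (ρ : ℂ) : ℝ) * selbergMinorantReal Δ (-h) h ((ρ : ℂ).im - t)| := by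
      refine hZs.congr fun ρ ↦ ?_
      rw [hterm, Complex.norm_real, Real.norm_eq_abs]
    exact h1.of_abs
  set Zr : ℝ := ∑' ρ : ZetaZeros.riemannZetaNontrivialZeros,
    (riemannZetaZeroOrder (ρ : ℂ) : ℝ) * selbergMinorantReal Δ (-h) h ((ρ : ℂ).im - t) with hZr
  have hLHS : ∑' ρ : ZetaZeros.riemannZetaNontrivialZeros,
      (riemannZetaZeroOrder (ρ : ℂ) : ℂ) * F ((((ρ : ℂ).im - t : ℝ)) : ℂ) = (Zr : ℂ) := by
    rw [hZr, Complex.ofReal_tsum]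
    exact tsum_congr hterm
  have hcount := tsum_le_zetaZeroCount_sub (t := t) hΔ0 hh0 hht hZs'
  -- (2) the prime side as a real finite sum
  set N : ℕ := ⌊Real.exp (2 * π * Δ)⌋₊ with hN
  set w : ℝ → ℝ := fun ξ ↦ (𝓕 (fun x : ℝ ↦ F x) ξ).re with hw
  set term : ℕ → ℝ := fun n ↦ (vonMangoldt n : ℝ) / Real.sqrt n * (1 / π * w (Real.log n / (2 * π)) *
    Real.cos (t * Real.log n)) with htermdef
  have hS : ∑' n : ℕ, ((vonMangoldt n : ℝ) : ℂ) / (Real.sqrt n : ℂ) *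
      ((1 / (2 * π) : ℂ) * (Complex.exp (-(t * Real.log n) * I) * 𝓕 (fun x : ℝ ↦ F x) (Real.log n / (2 * π))
        + Complex.exp ((t * Real.log n) * I) * 𝓕 (fun x : ℝ ↦ F x) (-(Real.log n / (2 * π))))) =
      ((∑ n ∈ Finset.Ioc 0 N, term n : ℝ) : ℂ) := by
    rw [tsum_eq_sum (s := Finset.Ioc 0 N)]
    · rw [Complex.ofReal_sum]
      refine Finset.sum_congr rfl fun n _ ↦ ?_
      simp only [htermdef, hw, hFdef]
      exact primeTerm_minorant_eq_ofReal Δ h t n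
    · intro n hn
      rw [Finset.mem_Ioc, not_and_or, not_lt, not_le] at hn
      rcases hn with hn | hn
      · have : n = 0 := by omega
        subst this; simp
      · -- `n > e^{2πΔ}`: both Fourier values vanish
        have hn1 : Real.exp (2 * π * Δ) < n := by
          have := Nat.lt_floor_add_one (Real.exp (2 * π * Δ))
          rw [← hN] at this
          exact this.trans_le (by exact_mod_cast hn)
        have hnpos : (0 : ℝ) < n := (Real.exp_pos _).trans hn1
        have hξ : Δ ≤ |Real.log n / (2 * π)| := by
          rw [abs_of_pos (div_pos (Real.log_pos (by
            have : (1 : ℝ) < Real.exp (2 * π * Δ) := by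
              have : (0:ℝ) < 2 * π * Δ := by positivity
              exact Real.one_lt_exp_iff.2 this
            linarith)) (by positivity))]
          rw [le_div_iff₀ (by positivity), ← Real.log_exp (Δ * (2 * π))]
          refine Real.log_le_log (Real.exp_pos _) ?_
          rw [show Δ * (2 * π) = 2 * π * Δ by ring]; exact hn1.le
        have hξ' : Δ ≤ |-(Real.log n / (2 * π))| := by rwa [abs_neg]
        rw [hsupp _ hξ, hsupp _ hξ']
        simp
  -- split the finite sum: primes / proper prime powers / the rest
  have hsplit : ∑ n ∈ Finset.Ioc 0 N, term n =
      ∑ p ∈ (Finset.Ioc 0 N).filter Nat.Prime, term p +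
        ∑ n ∈ (Finset.Ioc 0 N).filter (fun n ↦ IsPrimePow n ∧ ¬ n.Prime), term n := by
    rw [← Finset.sum_filter_add_sum_filter_not (Finset.Ioc 0 N) Nat.Prime term]
    congr 1
    rw [← Finset.sum_filter_add_sum_filter_not ((Finset.Ioc 0 N).filter (fun n ↦ ¬ n.Prime)) IsPrimePow term]
    have hzero : ∑ n ∈ ((Finset.Ioc 0 N).filter (fun n ↦ ¬ n.Prime)).filter (fun n ↦ ¬ IsPrimePow n), term n = 0 := by
      refine Finset.sum_eq_zero fun n hn ↦ ?_
      rw [Finset.mem_filter] at hn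
      simp only [htermdef, ArithmeticFunction.vonMangoldt_eq_zero_iff.2 hn.2, zero_div, zero_mul]
    rw [hzero, add_zero, Finset.filter_filter]
    refine Finset.sum_congr ?_ fun _ _ ↦ rfl
    ext n; simp only [Finset.mem_filter]; tauto
  have hprimes : ∑ p ∈ (Finset.Ioc 0 N).filter Nat.Prime, term p =
      (1 / π) * ∑ p ∈ (Finset.Ioc 0 N).filter Nat.Prime,
        Real.log p / Real.sqrt p * w (Real.log p / (2 * π)) * Real.cos (t * Real.log p) := by
    rw [Finset.mul_sum]
    refine Finset.sum_congr rfl fun p hp ↦ ?_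
    rw [Finset.mem_filter] at hp
    simp only [htermdef, ArithmeticFunction.vonMangoldt_apply_prime hp.2]
    ring
  have hpp : |∑ n ∈ (Finset.Ioc 0 N).filter (fun n ↦ IsPrimePow n ∧ ¬ n.Prime), term n| ≤
      14 * (Real.log Δ + Real.log (2 * π) + 4) := by
    refine (Finset.abs_sum_le_sum_abs _ _).trans ?_
    have hle : ∀ n ∈ (Finset.Ioc 0 N).filter (fun n ↦ IsPrimePow n ∧ ¬ n.Prime), |term n| ≤ 4 * (1 / Real.sqrt n) := by
      intro n hn
      rw [Finset.mem_filter] at hn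
      have hn2 : 2 ≤ n := hn.2.1.two_le
      have hnpos : (0 : ℝ) < n := by exact_mod_cast (by omega : 0 < n)
      have h4 := abs_log_mul_re_fourier_selbergMinorant_le hΔ0 hh0.le hn2
      have hΛ : (vonMangoldt n : ℝ) ≤ Real.log n := ArithmeticFunction.vonMangoldt_le_log
      have hΛ0 : (0 : ℝ) ≤ vonMangoldt n := ArithmeticFunction.vonMangoldt_nonneg
      have hlogpos : 0 < Real.log n := Real.log_pos (by exact_mod_cast hn2)
      simp only [htermdef, hw, hFdef]
      rw [abs_mul, abs_div, abs_of_nonneg hΛ0, abs_of_pos (Real.sqrt_pos.2 hnpos)]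
      have hcos : |Real.cos (t * Real.log n)| ≤ 1 := Real.abs_cos_le_one _
      have hkey : |1 / π * (𝓕 (fun x : ℝ ↦ selbergMinorant Δ (-h) h x) (Real.log n / (2 * π))).re *
          Real.cos (t * Real.log n)| ≤ 4 / Real.log n := by
        rw [abs_mul]
        have h5 : |1 / π * (𝓕 (fun x : ℝ ↦ selbergMinorant Δ (-h) h x) (Real.log n / (2 * π))).re| ≤ 4 / Real.log n := by
          rw [le_div_iff₀ hlogpos]
          calc |1 / π * (𝓕 (fun x : ℝ ↦ selbergMinorant Δ (-h) h x) (Real.log n / (2 * π))).re| * Real.log n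
              = |Real.log n / π * (𝓕 (fun x : ℝ ↦ selbergMinorant Δ (-h) h x) (Real.log n / (2 * π))).re| := by
                rw [abs_mul, abs_mul, abs_of_pos (by positivity : (0 : ℝ) < 1 / π),
                  abs_of_pos (by positivity : (0 : ℝ) < Real.log n / π)]
                ring
            _ ≤ 4 := h4
        calc |1 / π * (𝓕 (fun x : ℝ ↦ selbergMinorant Δ (-h) h x) (Real.log n / (2 * π))).re| *
              |Real.cos (t * Real.log n)| ≤ 4 / Real.log n * 1 := by
              gcongr
          _ = 4 / Real.log n := mul_one _
      calc (vonMangoldt n : ℝ) / Real.sqrt n *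
            |1 / π * (𝓕 (fun x : ℝ ↦ selbergMinorant Δ (-h) h x) (Real.log n / (2 * π))).re * Real.cos (t * Real.log n)|
          ≤ Real.log n / Real.sqrt n * (4 / Real.log n) := by gcongr
        _ = 4 * (1 / Real.sqrt n) := by field_simp
    calc ∑ n ∈ (Finset.Ioc 0 N).filter (fun n ↦ IsPrimePow n ∧ ¬ n.Prime), |term n|
        ≤ ∑ n ∈ (Finset.Ioc 0 N).filter (fun n ↦ IsPrimePow n ∧ ¬ n.Prime), 4 * (1 / Real.sqrt n) :=
          Finset.sum_le_sum hle
      _ = 4 * ∑ n ∈ (Finset.Ioc 0 N).filter (fun n ↦ IsPrimePow n ∧ ¬ n.Prime), (1 / Real.sqrt n : ℝ) := by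
          rw [Finset.mul_sum]
      _ ≤ 4 * ((7 / 2) * ∑ p ∈ (Finset.Ioc 0 N).filter Nat.Prime, (1 / p : ℝ)) := by
          gcongr
          have hX : (2 : ℝ) ≤ Real.exp (2 * π * Δ) := by
            have : (2 : ℝ) ≤ 2 * π * Δ + 1 := by nlinarith [Real.pi_gt_three]
            exact this.trans (Real.add_one_le_exp _)
          exact sum_properPrimePow_inv_sqrt_le hX
      _ ≤ 4 * ((7 / 2) * (Real.log Δ + Real.log (2 * π) + 4)) := by
          gcongr
          exact sum_inv_prime_le_log Δ hΔ1
      _ = 14 * (Real.log Δ + Real.log (2 * π) + 4) := by ring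
  -- (3) the archimedean side is real and bounded below
  have hF0 : 𝓕 (fun x : ℝ ↦ F x) 0 = ((2 * h - 1 / Δ : ℝ) : ℂ) := by
    rw [hFdef, fourier_selbergMinorant_zero hΔ0 hab]
    congr 1; ring
  have hIint : (∫ u : ℝ, F ((u - t : ℝ) : ℂ) * (reDigammaQuarter u : ℂ)) =
      ((∫ u : ℝ, selbergMinorantReal Δ (-h) h (u - t) * reDigammaQuarter u : ℝ) : ℂ) := by
    rw [← integral_complex_ofReal]
    refine integral_congr_ae (Eventually.of_forall fun u ↦ ?_)
    simp only [hFreal, Complex.ofReal_mul]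
  set Ir : ℝ := ∫ u : ℝ, selbergMinorantReal Δ (-h) h (u - t) * reDigammaQuarter u with hIr
  have hIr : (2 * h - 1 / Δ) * Real.log (t / 2) - |C_E| ≤ Ir := by
    have := hCE Δ t h hΔ1 ht hh0 hh1
    have h2 := (abs_le.1 this).1
    linarith [le_abs_self C_E, neg_abs_le C_E]
  have hArch : ((1 / (2 * π) : ℂ) * (∫ u : ℝ, F ((u - t : ℝ) : ℂ) * (reDigammaQuarter u : ℂ))
      - (1 / (2 * π) : ℂ) * 𝓕 (fun x : ℝ ↦ F x) 0 * (Real.log π : ℂ)) =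
      ((1 / (2 * π) * (Ir - (2 * h - 1 / Δ) * Real.log π) : ℝ) : ℂ) := by
    rw [hIint, hF0]; push_cast; ring
  have hArch_ge : 2 * h * Real.log (t / (2 * π)) / (2 * π) - Real.log t / (2 * π * Δ) - |C_E| / (2 * π) ≤
      1 / (2 * π) * (Ir - (2 * h - 1 / Δ) * Real.log π) := by
    have hlogsplit : Real.log (t / 2) - Real.log π = Real.log (t / (2 * π)) := by
      rw [← Real.log_div (by positivity) Real.pi_ne_zero]
      congr 1; field_simp
    have h1 : (2 * h - 1 / Δ) * Real.log (t / (2 * π)) - |C_E| ≤ Ir - (2 * h - 1 / Δ) * Real.log π := by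
      rw [← hlogsplit]; nlinarith
    have h2 : (1 / Δ) * Real.log (t / (2 * π)) ≤ (1 / Δ) * Real.log t := by
      refine mul_le_mul_of_nonneg_left (Real.log_le_log (by positivity) ?_) (by positivity)
      rw [div_le_iff₀ (by positivity)]; nlinarith [Real.pi_gt_three]
    have hπ2 : (0 : ℝ) < 1 / (2 * π) := by positivity
    calc 2 * h * Real.log (t / (2 * π)) / (2 * π) - Real.log t / (2 * π * Δ) - |C_E| / (2 * π)
        = 2 * h * Real.log (t / (2 * π)) / (2 * π) - 1 / (2 * π) * ((1 / Δ) * Real.log t) - |C_E| / (2 * π) := by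
          field_simp
      _ ≤ 2 * h * Real.log (t / (2 * π)) / (2 * π) - 1 / (2 * π) * ((1 / Δ) * Real.log (t / (2 * π))) -
            |C_E| / (2 * π) := by gcongr
      _ = 1 / (2 * π) * ((2 * h - 1 / Δ) * Real.log (t / (2 * π)) - |C_E|) := by ring
      _ ≤ 1 / (2 * π) * (Ir - (2 * h - 1 / Δ) * Real.log π) := mul_le_mul_of_nonneg_left h1 hπ2.le
  -- (4) the polar side
  have hP : -2 ≤ (selbergMinorant Δ (-h) h (I / 2 - t)).re + (selbergMinorant Δ (-h) h (-(I / 2) - t)).re := by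
    have h1 := norm_selbergMinorant_polar_le_long (Δ := Δ) (t := t) ht4 hΔ hexp hh0 hht4 1 (Or.inl rfl)
    have h2 := norm_selbergMinorant_polar_le_long (Δ := Δ) (t := t) ht4 hΔ hexp hh0 hht4 (-1) (Or.inr rfl)
    simp only [Complex.ofReal_one, one_mul, Complex.ofReal_neg, neg_one_mul] at h1 h2
    have h3 := (Complex.abs_re_le_norm (selbergMinorant Δ (-h) h (I / 2 - t))).trans h1
    have h4 := (Complex.abs_re_le_norm (selbergMinorant Δ (-h) h (-(I / 2) - t))).trans h2
    have h3' := (abs_le.1 h3).1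
    have h4' := (abs_le.1 h4).1
    linarith
  -- (5) assemble
  rw [hLHS, hS, hArch] at hEqn
  have hre := congrArg Complex.re hEqn
  simp only [Complex.ofReal_re, Complex.sub_re, Complex.add_re] at hre
  rw [hsplit, hprimes] at hre
  have hpp' := (abs_le.1 hpp).2
  have hfinal : -2 - (1 / π) * ∑ p ∈ (Finset.Ioc 0 N).filter Nat.Prime,
        Real.log p / Real.sqrt p * w (Real.log p / (2 * π)) * Real.cos (t * Real.log p)
      - 14 * (Real.log Δ + Real.log (2 * π) + 4)
      + (2 * h * Real.log (t / (2 * π)) / (2 * π) - Real.log t / (2 * π * Δ) - |C_E| / (2 * π)) ≤ Zr := by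
    linarith
  have hCbound : 2 + 14 * (Real.log (2 * π) + 4) + |C_E| / (2 * π) ≤ (B₀ / Real.log 2) * Real.log Δ := by
    rw [div_mul_eq_mul_div, le_div_iff₀ hlog2]
    have : 2 + 14 * (Real.log (2 * π) + 4) + |C_E| / (2 * π) = B₀ := by rw [hB₀]; ring
    rw [this]
    nlinarith
  calc -(Real.log t / (2 * π * Δ))
        - (1 / π) * ∑ p ∈ (Finset.Ioc 0 N).filter Nat.Prime,
            Real.log p / Real.sqrt p * w (Real.log p / (2 * π)) * Real.cos (t * Real.log p)
        - (14 + B₀ / Real.log 2) * Real.log Δ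
      ≤ Zr - 2 * h * Real.log (t / (2 * π)) / (2 * π) := by nlinarith
    _ ≤ ((zetaZeroCount (t + h) : ℝ) - zetaZeroCount (t - h)) - 2 * h * Real.log (t / (2 * π)) / (2 * π) := by
        linarith

end ShortIntervalsRHLong

end Literature.NumberTheory.LFunctions
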